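import Mathlib
import Summits.ValiantsHypothesis.ValiantsHypothesis.Theorems.BarrierLeverPartitionMinorsHitByVPHiddenStatesSymbolicStep
import Summits.ValiantsHypothesis.ValiantsHypothesis.Theorems.BarrierLeverPartitionMinorsHitByVPHiddenStatesMonotone

/-!
# Route BarrierLever — item `PartitionMinorsHitByVP` (stmt-ValiantsHypothesis-19717), line `hidden-states`:
# NESTED STACKING — served configurations are closed under cones with a marker state, and under CUBE FACTORS (cylinders)

Helper file (`--supports stmt-ValiantsHypothesis-19717`; cell valiant-natproofs, rung V4, 𝒟-side door (c), registered line
`Cruxes/PartitionMinorsHitByVP/Lines/hidden_states.lean` v7; prover seat val-np-p6 gen 10). Definition-free; closes NO item.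

THE POINT. The split step of the fitting criterion (`SymbJoin.symGood_of_split_enum`, p3 g10) is usually read TOP-DOWN (cut a
configuration into a deletion part and a link part). Read BOTTOM-UP it is a CLOSURE PROPERTY of the class of generically good
configurations `(u, e)` (`symDet u e ≠ 0`):

* `symGood_of_stack` — **NESTED STACKING.** Let `x` be a coordinate and `qs p` a MARKER STATE of each piece `p`. If the rows avoiding `x`
  together with the columns NOT containing their piece's marker form a generically good configuration, and the rows containing `x` (with
  `x` erased) together with the columns containing the marker (with the marker erased) form one too, then `(u, e)` is generically good.
  No relation between the two sub-configurations is required (they may share pieces and states: the symbolic table is common, and a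
  product of nonzero polynomials is nonzero). Proof: the cut `β = 0`, `γ_{p,q} = [q = qs p]` has cut value `ξ_k = [marker ∈ column k]`,
  and the link child is the marker-erased configuration up to the substitution `X_{(p, some (qs p), a)} ↦ 0` (`symDet_ne_zero_of_specialisation`).
* `symGood_cylinder` — **CUBE FACTORS COST ONE IDLE STATE.** If `(u, e)` is generically good, `x` is a coordinate unused by `u` and
  `qs p` a state unused by the columns of piece `p`, then the CYLINDER `u × {∅, {x}}` (rows `u i` and `u i ∪ {x}`) is generically good for the
  doubled design `e × {∅, marker}` (columns `(p, J)` and `(p, J ∪ {qs p})`) — same pieces, same table variables.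
* `cylinder_injective`, `cylinder_threshold` — the doubled design of an injective legal STRICT THRESHOLD join family is injective and legal
  (the marker gets weight `0`; every other weight is kept), so the wide-design budget (`m ≤ 2h` pieces, `K ≤ h³` states) is untouched.
* `cylinder_node` — the numeric form used by the line's stubs: a legal wide design good for `u` (`∃ tx, det ≠ 0`) with an idle state in
  every piece yields a legal wide design good for the cylinder `u × {∅,{x}}`; iterating, for `u × 2^C` with `|C|` idle states.

CONSEQUENCES FOR THE LINE. (i) Every class of served row families proved so far (star joins p578997, hub joins p584941 / HubWide, ball
and knapsack tilings ⊔ free rows p603335/p604859/p605620/p605730, the antipodal classes p590044/p590814) extends to all CYLINDERS over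
its members at no cost in pieces — e.g. `(u ⊔ R) × 2^C` for a ball tiling `u`, `|R| ≤ h+1` arbitrary rows, `C` disjoint coordinates; for
the pair node `Stmt.pairJoinWideLower` the served PAIRS are closed under a common cube factor. (ii) The hub-join design of val-np-p8 IS the
stack of a star on a sub-star (marker = hub): `symGood_of_stack` is the rigid core of `HubAxis.hubJoin_good_of_balanced` (exact balance),
and iterating it on a flag of sub-designs `e ⊇ e¹ ⊇ e² ⊇ …` gives the general «flag cylinder» classes. (iii) For the census: the
cube-product families `cube^j × colex` that exhaust the type game are cylinders over colex tilings, hence served by TAILORED designs for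
every `h` — the open question there concerns only the UNIVERSAL peel design.

WHAT THIS IS NOT: no stub of the line is closed (the stubs ask for ONE design per `(h, r)` good for ALL row families, or for all lower
pairs); nothing on crux 14610 or VP ≠ VNP.
-/

set_option linter.dupNamespace false

namespace Summit.ValiantsHypothesis.ValiantsHypothesis.Theorems.BarrierLever.HiddenStates

open Finset Matrix MvPolynomial

noncomputable section

namespace SymbJoin

variable {h m K r r₀ r₁ : ℕ}

/-! ## 1. Erasing a marker state is a specialisation -/

/-- The substitution killing the marker state of every piece (`X_{(p, some (qs p), a)} ↦ 0`, identity elsewhere) sends the hidden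
point of a column `(p, J)` to the hidden point of `(p, J ∖ {qs p})`. -/
theorem eraseMarker_symPoint (qs : Fin m → Fin K) (e : Fin r → Fin m × Finset (Fin K)) (k : Fin r) (a : Fin h) :
    (MvPolynomial.aeval (R := ℂ) fun v : Var m K h =>
        if v.2.1 = some (qs v.1) then (0 : MvPolynomial (Var m K h) ℂ) else X v) (symPoint e k a)
      = symPoint (fun k => ((e k).1, ((e k).2).erase (qs (e k).1))) k a := by
  classical
  rw [symPoint, symPoint, map_add, map_sum]
  simp only [MvPolynomial.aeval_X]
  rw [if_neg (by simp)]
  congr 1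
  have hg : ∀ q : Fin K, (if (some q : Option (Fin K)) = some (qs (e k).1) then (0 : MvPolynomial (Var m K h) ℂ)
      else X ((e k).1, some q, a)) = if q = qs (e k).1 then 0 else X ((e k).1, some q, a) := by
    intro q
    by_cases hq : q = qs (e k).1
    · rw [if_pos (by rw [hq]), if_pos hq]
    · rw [if_neg (fun h' => hq (Option.some_injective _ h')), if_neg hq]
  rw [Finset.sum_congr rfl fun q _ => hg q,
    ← Finset.sum_erase (e k).2 (f := fun q => if q = qs (e k).1 then (0 : MvPolynomial (Var m K h) ℂ)
      else X ((e k).1, some q, a)) (a := qs (e k).1) (by simp)]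
  exact Finset.sum_congr rfl fun q hq => by rw [if_neg (Finset.ne_of_mem_erase hq)]

/-- **Marker erasure.** If the configuration with the marker state erased from every column is generically good, so is the original. -/
theorem symGood_of_eraseMarker (u : Fin r → Finset (Fin h)) (e : Fin r → Fin m × Finset (Fin K)) (qs : Fin m → Fin K)
    (hG : symDet u (fun k => ((e k).1, ((e k).2).erase (qs (e k).1))) ≠ 0) : symDet u e ≠ 0 :=
  symDet_ne_zero_of_specialisation u _ e
    (MvPolynomial.aeval fun v : Var m K h => if v.2.1 = some (qs v.1) then (0 : MvPolynomial (Var m K h) ℂ) else X v)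
    (fun k a => eraseMarker_symPoint qs e k a) hG

/-! ## 2. Nested stacking -/

/-- **NESTED STACKING.** Rows `f₀ j` avoid the coordinate `x`, rows `f₁ j` contain it; columns `g₀ j` avoid their piece's marker state
`qs p`, columns `g₁ j` contain it; both enumerations are injective and exhaust `Fin r`. If the deletion configuration `(u ∘ f₀, e ∘ g₀)`
and the MARKER-ERASED link configuration `(x erased from u ∘ f₁, qs erased from e ∘ g₁)` are generically good, then so is `(u, e)`. -/
theorem symGood_of_stack (u : Fin r → Finset (Fin h)) (e : Fin r → Fin m × Finset (Fin K)) (x : Fin h) (qs : Fin m → Fin K)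
    (hr : r₀ + r₁ = r) (f₀ : Fin r₀ → Fin r) (f₁ : Fin r₁ → Fin r) (g₀ : Fin r₀ → Fin r) (g₁ : Fin r₁ → Fin r)
    (hf : Function.Injective (Sum.elim f₀ f₁)) (hg : Function.Injective (Sum.elim g₀ g₁))
    (hrow0 : ∀ j, x ∉ u (f₀ j)) (hrow1 : ∀ j, x ∈ u (f₁ j))
    (hcol0 : ∀ j, qs (e (g₀ j)).1 ∉ (e (g₀ j)).2) (hcol1 : ∀ j, qs (e (g₁ j)).1 ∈ (e (g₁ j)).2)
    (h0 : symDet (fun j : Fin r₀ => u (f₀ j)) (fun j => e (g₀ j)) ≠ 0)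
    (h1 : symDet (fun j : Fin r₁ => (u (f₁ j)).erase x)
      (fun j => ((e (g₁ j)).1, ((e (g₁ j)).2).erase (qs (e (g₁ j)).1))) ≠ 0) :
    symDet u e ≠ 0 := by
  classical
  refine symGood_of_split_enum u e x (fun _ => 0) (fun p q => if q = qs p then 1 else 0) hr f₀ f₁ g₀ g₁ hf hg hrow0 hrow1
    ?_ ?_ h0 (symGood_of_eraseMarker _ _ qs h1)
  · intro j
    rw [xi, zero_add]
    refine Finset.sum_eq_zero fun q hq => ?_
    rw [if_neg]
    rintro rfl
    exact hcol0 j hq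
  · intro j
    rw [xi, zero_add, Finset.sum_ite_eq' (e (g₁ j)).2 (qs (e (g₁ j)).1), if_pos (hcol1 j)]
    exact one_ne_zero

/-! ## 3. Cylinders (cube factors) -/

/-- **CYLINDERS ARE SERVED BY THE DOUBLED DESIGN.** Let `(u, e)` be generically good, `x` a coordinate avoided by every row and `qs p`
a state avoided by every column of piece `p`. The cylinder `u × {∅,{x}}` — rows `u' (f₀ j) = u j`, `u' (f₁ j) = u j ∪ {x}` — is
generically good for the doubled design `e' (f₀ j) = e j`, `e' (f₁ j) = (p, J ∪ {qs p})` (`(p, J) = e j`). -/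
theorem symGood_cylinder {r' : ℕ} (u : Fin r → Finset (Fin h)) (e : Fin r → Fin m × Finset (Fin K)) (x : Fin h)
    (qs : Fin m → Fin K) (hx : ∀ i, x ∉ u i) (hq : ∀ k, qs (e k).1 ∉ (e k).2)
    (u' : Fin r' → Finset (Fin h)) (e' : Fin r' → Fin m × Finset (Fin K)) (hr : r + r = r')
    (f₀ f₁ : Fin r → Fin r') (hf : Function.Injective (Sum.elim f₀ f₁))
    (hu0 : ∀ j, u' (f₀ j) = u j) (hu1 : ∀ j, u' (f₁ j) = insert x (u j))
    (he0 : ∀ j, e' (f₀ j) = e j) (he1 : ∀ j, e' (f₁ j) = ((e j).1, insert (qs (e j).1) (e j).2))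
    (hG : symDet u e ≠ 0) : symDet u' e' ≠ 0 := by
  classical
  refine symGood_of_stack u' e' x qs hr f₀ f₁ f₀ f₁ hf hf ?_ ?_ ?_ ?_ ?_ ?_
  · intro j; rw [hu0]; exact hx j
  · intro j; rw [hu1]; exact Finset.mem_insert_self _ _
  · intro j; rw [he0]; exact hq j
  · intro j; rw [he1]; exact Finset.mem_insert_self _ _
  · have hu : (fun j : Fin r => u' (f₀ j)) = u := funext hu0
    have he : (fun j : Fin r => e' (f₀ j)) = e := funext he0
    rw [hu, he]; exact hG
  · have hu : (fun j : Fin r => (u' (f₁ j)).erase x) = u := by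
      funext j; rw [hu1, Finset.erase_insert (hx j)]
    have he : (fun j : Fin r => ((e' (f₁ j)).1, ((e' (f₁ j)).2).erase (qs (e' (f₁ j)).1))) = e := by
      funext j; rw [he1]; dsimp only; rw [Finset.erase_insert (hq j)]
    rw [hu, he]; exact hG

/-- The doubled design of an injective family with idle markers is injective. -/
theorem cylinder_injective {r' : ℕ} (e : Fin r → Fin m × Finset (Fin K)) (he : Function.Injective e)
    (qs : Fin m → Fin K) (hq : ∀ k, qs (e k).1 ∉ (e k).2)
    (e' : Fin r' → Fin m × Finset (Fin K)) (hr : r + r = r')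
    (f₀ f₁ : Fin r → Fin r') (hf : Function.Injective (Sum.elim f₀ f₁))
    (he0 : ∀ j, e' (f₀ j) = e j) (he1 : ∀ j, e' (f₁ j) = ((e j).1, insert (qs (e j).1) (e j).2)) :
    Function.Injective e' := by
  classical
  have hbij := bijective_sumElim f₀ f₁ hr hf
  intro k k' hkk
  obtain ⟨s, rfl⟩ := hbij.2 k
  obtain ⟨s', rfl⟩ := hbij.2 k'
  congr 1
  rcases s with j | j <;> rcases s' with j' | j'
  · simp only [Sum.elim_inl] at hkk ⊢
    rw [he0, he0] at hkk
    rw [he hkk]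
  · exfalso
    simp only [Sum.elim_inl, Sum.elim_inr] at hkk
    rw [he0, he1] at hkk
    have h2 := congrArg Prod.snd hkk
    have h1 := congrArg Prod.fst hkk
    dsimp only at h1 h2
    apply hq j
    rw [h2, h1]
    exact Finset.mem_insert_self _ _
  · exfalso
    simp only [Sum.elim_inl, Sum.elim_inr] at hkk
    rw [he0, he1] at hkk
    have h2 := congrArg Prod.snd hkk
    have h1 := congrArg Prod.fst hkk
    dsimp only at h1 h2
    apply hq j'
    rw [← h2, ← h1]
    exact Finset.mem_insert_self _ _
  · simp only [Sum.elim_inr] at hkk ⊢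
    rw [he1, he1] at hkk
    have h1 := congrArg Prod.fst hkk
    have h2 := congrArg Prod.snd hkk
    dsimp only at h1 h2
    have hjj : j = j' := by
      apply he
      refine Prod.ext h1 ?_
      have : (insert (qs (e j).1) (e j).2).erase (qs (e j).1) = (insert (qs (e j').1) (e j').2).erase (qs (e j).1) := by
        rw [h2]
      rwa [Finset.erase_insert (hq j), h1, Finset.erase_insert (hq j')] at this
    rw [hjj]

/-- **The doubled design is a legal strict threshold family** for the same offsets and the weights with the marker set to `0`. -/
theorem cylinder_threshold {r' : ℕ} (e : Fin r → Fin m × Finset (Fin K)) (W : Fin m → ℕ) (wt : Fin m → Fin K → ℕ)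
    (hthr : ∀ x : Fin m × Finset (Fin K), x ∉ Set.range e →
      ∀ i, W (e i).1 + ∑ k ∈ (e i).2, wt (e i).1 k < W x.1 + ∑ k ∈ x.2, wt x.1 k)
    (qs : Fin m → Fin K) (hq : ∀ k, qs (e k).1 ∉ (e k).2)
    (e' : Fin r' → Fin m × Finset (Fin K)) (hr : r + r = r')
    (f₀ f₁ : Fin r → Fin r') (hf : Function.Injective (Sum.elim f₀ f₁))
    (he0 : ∀ j, e' (f₀ j) = e j) (he1 : ∀ j, e' (f₁ j) = ((e j).1, insert (qs (e j).1) (e j).2)) :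
    ∀ x : Fin m × Finset (Fin K), x ∉ Set.range e' →
      ∀ i, W (e' i).1 + ∑ k ∈ (e' i).2, (fun p q => if q = qs p then 0 else wt p q) (e' i).1 k <
        W x.1 + ∑ k ∈ x.2, (fun p q => if q = qs p then 0 else wt p q) x.1 k := by
  classical
  have hbij := bijective_sumElim f₀ f₁ hr hf
  -- the marker-free weight of a set equals the old weight of the set with the marker erased
  have hwt : ∀ (p : Fin m) (J : Finset (Fin K)),
      ∑ k ∈ J, (if k = qs p then 0 else wt p k) = ∑ k ∈ J.erase (qs p), wt p k := by
    intro p J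
    rw [← Finset.sum_erase J (f := fun k => if k = qs p then 0 else wt p k) (a := qs p) (by simp)]
    exact Finset.sum_congr rfl fun k hk => by rw [if_neg (Finset.ne_of_mem_erase hk)]
  intro x hx i
  -- the erased set of `x` is not a column of `e`
  have hx' : ((x.1, x.2.erase (qs x.1)) : Fin m × Finset (Fin K)) ∉ Set.range e := by
    rintro ⟨k, hk⟩
    apply hx
    by_cases hmem : qs x.1 ∈ x.2
    · refine ⟨f₁ k, ?_⟩
      rw [he1]
      have h1 : (e k).1 = x.1 := by rw [hk]
      have h2 : (e k).2 = x.2.erase (qs x.1) := by rw [hk]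
      ext1
      · exact h1
      · dsimp only; rw [h2, h1, Finset.insert_erase hmem]
    · refine ⟨f₀ k, ?_⟩
      rw [he0, hk]
      ext1
      · rfl
      · exact Finset.erase_eq_of_notMem hmem
  -- the member `i` is an old member, possibly with the marker added
  obtain ⟨s, rfl⟩ := hbij.2 i
  have hi : ∃ j, (e' (Sum.elim f₀ f₁ s)).1 = (e j).1 ∧ ((e' (Sum.elim f₀ f₁ s)).2).erase (qs (e' (Sum.elim f₀ f₁ s)).1) = (e j).2 := by
    rcases s with j | j
    · refine ⟨j, ?_, ?_⟩ <;> simp only [Sum.elim_inl, he0]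
      exact Finset.erase_eq_of_notMem (hq j)
    · refine ⟨j, ?_, ?_⟩ <;> simp only [Sum.elim_inr, he1]
      exact Finset.erase_insert (hq j)
  obtain ⟨j, hj1, hj2⟩ := hi
  have := hthr _ hx' j
  rw [hwt, hwt, hj2, hj1]
  simpa using this

/-! ## 4. The numeric form for the line's stubs -/

/-- **CYLINDERS OVER SERVED FAMILIES ARE SERVED (numeric form).** A legal strict-threshold join design good for `u` (`∃ tx, det ≠ 0`)
with an idle marker state in every piece yields — with the same pieces, states and offsets — a legal design good for the cylinder
`u × {∅,{x}}` over any coordinate `x` unused by `u`. -/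
theorem cylinder_node {r' : ℕ} (u : Fin r → Finset (Fin h)) (e : Fin r → Fin m × Finset (Fin K)) (he : Function.Injective e)
    (W : Fin m → ℕ) (wt : Fin m → Fin K → ℕ)
    (hthr : ∀ x : Fin m × Finset (Fin K), x ∉ Set.range e →
      ∀ i, W (e i).1 + ∑ k ∈ (e i).2, wt (e i).1 k < W x.1 + ∑ k ∈ x.2, wt x.1 k)
    (hgood : ∃ tx : Fin m → Option (Fin K) → Fin h → ℂ,
      (Matrix.of fun i k : Fin r =>
        ∏ a ∈ u i, (tx (e k).1 none a + ∑ q ∈ (e k).2, tx (e k).1 (some q) a)).det ≠ 0)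
    (x : Fin h) (hx : ∀ i, x ∉ u i) (qs : Fin m → Fin K) (hq : ∀ k, qs (e k).1 ∉ (e k).2)
    (u' : Fin r' → Finset (Fin h)) (e' : Fin r' → Fin m × Finset (Fin K)) (hr : r + r = r')
    (f₀ f₁ : Fin r → Fin r') (hf : Function.Injective (Sum.elim f₀ f₁))
    (hu0 : ∀ j, u' (f₀ j) = u j) (hu1 : ∀ j, u' (f₁ j) = insert x (u j))
    (he0 : ∀ j, e' (f₀ j) = e j) (he1 : ∀ j, e' (f₁ j) = ((e j).1, insert (qs (e j).1) (e j).2)) :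
    ∃ wt' : Fin m → Fin K → ℕ, Function.Injective e' ∧
      (∀ x : Fin m × Finset (Fin K), x ∉ Set.range e' →
        ∀ i, W (e' i).1 + ∑ k ∈ (e' i).2, wt' (e' i).1 k < W x.1 + ∑ k ∈ x.2, wt' x.1 k) ∧
      ∃ tx : Fin m → Option (Fin K) → Fin h → ℂ,
        (Matrix.of fun i k : Fin r' =>
          ∏ a ∈ u' i, (tx (e' k).1 none a + ∑ q ∈ (e' k).2, tx (e' k).1 (some q) a)).det ≠ 0 := by
  obtain ⟨tx, htx⟩ := hgood
  refine ⟨fun p q => if q = qs p then 0 else wt p q, cylinder_injective e he qs hq e' hr f₀ f₁ hf he0 he1,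
    cylinder_threshold e W wt hthr qs hq e' hr f₀ f₁ hf he0 he1, ?_⟩
  exact exists_table_of_symGood u' e'
    (symGood_cylinder u e x qs hx hq u' e' hr f₀ f₁ hf hu0 hu1 he0 he1 (symGood_of_table u e tx htx))

end SymbJoin

end

end Summit.ValiantsHypothesis.ValiantsHypothesis.Theorems.BarrierLever.HiddenStates
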